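import Mathlib
import Summits.QuantumAdvantage.QuantumAdvantage.Theorems.LinnikCubicClassGroupsPureCubicClassNumberHardDescentGalois
import Summits.QuantumAdvantage.QuantumAdvantage.Theorems.LinnikCubicClassGroupsPureCubicClassNumberHardRelNormQuadratic
import Summits.QuantumAdvantage.QuantumAdvantage.Theorems.LinnikCubicClassGroupsPureCubicClassNumberHardDescentLemmas
import HarnessLib

/-!
# Descent `3 ∣ h(K(ζ₃)) ⟹ 3 ∣ h(K)` for a cubic field `K ∋ ∛m`, without Hasse and without Brauer

Route `LinnikCubicClassGroups` (rank-0 hypothesis-type target `PureCubicClassNumberHard`,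
stmt-QuantumAdvantage-11826): the descent step of Honda's criterion (Honda 1971, Theorem) for the
case `p ≡ q ≡ 8 (mod 9)` (`…PureCubicClassNumberHardHonda88.lean`).  Classically the descent is
read off the Brauer–Kuroda class number relation `h(K(ζ₃)) = h(K)² q*/3` (Barrucand–Cohn) or
Chevalley's ambiguous class number formula with Hasse's norm theorem; here it is proved from the
non-commutativity `τστ = σ²` of `Gal(K(ζ₃)/ℚ) ≅ S₃`, the ideal norm `N_{L/K}(𝔄)𝓞_L = 𝔄 · τ𝔄`,
Cauchy's theorem on the `σ`-fixed classes and Hilbert 90, one class at a time: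

* `three_dvd_classNumber_descent` — see its docstring for the precise hypotheses (all supplied by
  `fieldSetup_twoPrimes` and `stub_ramificationCensus` for `m = pq`).

HONEST FRAMING (block-2b rule): kernel-checked classical algebraic number theory (Honda 1971), an
independent certification, NOT summit progress; the crux `PureCubicClassNumberHard` is
hypothesis-type and untouched.

## References
* T. Honda, *Pure cubic fields whose class numbers are multiples of three*, J. Number Theory 3
  (1971) 7–12, Theorem. [Honda1971]
* S. Aouissi, D. C. Mayer, M. C. Ismaili, M. Talbi, A. Azizi, *3-rank of ambiguous class groups of
  cubic Kummer extensions*, Period. Math. Hungar. 81 (2020), Thm. 2.3. [AouissiMayerIsmailiTalbiAzizi2020]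
* P. Barrucand, H. Cohn, *Remarks on principal factors in a relative cubic field*, J. Number
  Theory 3 (1971) 226–239. [folklore]
-/

set_option linter.dupNamespace false

open NumberField Polynomial

open scoped Pointwise NumberField nonZeroDivisors

namespace Summit.QuantumAdvantage.QuantumAdvantage.Theorems.LinnikCubicClassGroups

open Literature.NumberTheory.NumberFields

/-! ### The descent `3 ∣ h(L) ⟹ 3 ∣ h(K)` -/

/-- **Descent of `3`-divisibility from `L = K(ζ₃)` to the cubic field `K`, without the Brauer
class number relation and without Hasse's norm theorem.**  Setting: `K` cubic with `θ ∈ K`,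
`θ³ = m ≠ 0`, moved by `σ`; `L/K` quadratic Galois (`L = K(ζ₃)`); `F = ℚ(ζ₃) ⊆ L` with `𝓞_F` a
PID, units `±ζ^i`, `L/F` cyclic cubic with generator `σ`; the ramified primes of `L/F` are among
`P₁, P₂`, with `Pᵢ³ = (tᵢ)`, `tᵢ ∈ 𝓞_F`, and `Pᵢ = 𝔭ᵢ𝓞_L` for ideals `𝔭ᵢ` of `𝓞_K` with `𝔭ᵢ³`
principal.  Then `3 ∣ h(L) ⟹ 3 ∣ h(K)`.

Proof.  Suppose `3 ∤ h(K)`.  Then `𝔭ᵢ` (order dividing `gcd(3, h_K) = 1`) and hence every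
`σ`-invariant ideal `(c)P₁^aP₂^b` of `𝓞_L` is principal.  By Cauchy on the subgroup of `σ`-fixed
classes (`#Fix ≡ h_L (mod 3)`), some class `c = [I] ≠ 1` with `c³ = 1` is `σ`-fixed:
`(x)·σI = (y)·I`, and `N(x)·u = N(y)` for a unit `u`, necessarily `σ`-fixed, so `u = ±ζ^i` and
`τu = u⁻¹` for the generator `τ` of `Gal(L/K)` (`τστ = σ²`).  The class `τc = [τI]` satisfies
`(στy)·σ(τI) = (στx)·τI` with the SAME unit `u`, so `c·τc = [I·τI]` carries the unit `u²`; but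
`I·τI = N_{L/K}(I)𝓞_L` has order dividing `h_K` and `3`, so it is principal, `= (g)`, and comparing
`(xx')·(σg) = (yy')·(g)` gives a unit `η` with `N(η) = u²`, whence `N(η²u³) = u`: the relation of
`c` has a unit norm, and Hilbert 90 (`mk0_eq_one_of_rel`) gives `c = 1`, a contradiction.
[folklore] -/
theorem three_dvd_classNumber_descent
    (K : Type) [Field K] [NumberField K] (hK : Module.finrank ℚ K = 3)
    (L : Type) [Field L] [NumberField L] [Algebra K L] [IsGalois ℚ L] [IsGalois K L]
    (hKL : Module.finrank K L = 2)
    (F : IntermediateField ℚ L) [IsGalois F L] (hFL : Module.finrank F L = 3)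
    (hF2 : Module.finrank ℚ F = 2)
    (σ : L ≃ₐ[F] L) (hσ : ∀ g : L ≃ₐ[F] L, g ∈ Subgroup.zpowers σ)
    (hPID : IsPrincipalIdealRing (𝓞 F))
    (ζ : (𝓞 F)ˣ) (hζeq : (ζ : 𝓞 F) ^ 2 + ζ + 1 = 0)
    (hunits : ∀ w : (𝓞 F)ˣ, ∃ i : ℕ, w = ζ ^ i ∨ w = -ζ ^ i)
    {θ : K} {m : ℕ} (hm : m ≠ 0) (hθ3 : θ ^ 3 = (m : K))
    (hθσ : σ (algebraMap K L θ) ≠ algebraMap K L θ)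
    {P₁ P₂ : Ideal (𝓞 L)} (hP₁ : P₁.IsMaximal) (hP₂ : P₂.IsMaximal)
    {t₁ : 𝓞 F} (ht₁ : Ideal.span {algebraMap (𝓞 F) (𝓞 L) t₁} = P₁ ^ 3)
    {t₂ : 𝓞 F} (ht₂ : Ideal.span {algebraMap (𝓞 F) (𝓞 L) t₂} = P₂ ^ 3)
    (hram : ∀ Q : Ideal (𝓞 L), Q.IsMaximal → Q.ramificationIdx (𝓞 F) ≠ 1 → Q = P₁ ∨ Q = P₂)
    {𝔭₁ : Ideal (𝓞 K)} (h𝔭₁ : 𝔭₁.map (algebraMap (𝓞 K) (𝓞 L)) = P₁)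
    (h𝔭₁3 : (𝔭₁ ^ 3).IsPrincipal)
    {𝔭₂ : Ideal (𝓞 K)} (h𝔭₂ : 𝔭₂.map (algebraMap (𝓞 K) (𝓞 L)) = P₂)
    (h𝔭₂3 : (𝔭₂ ^ 3).IsPrincipal)
    (h3L : 3 ∣ classNumber L) : 3 ∣ classNumber K := by
  classical
  by_contra h3K
  have hcop : Nat.Coprime 3 (classNumber K) :=
    (Nat.Prime.coprime_iff_not_dvd Nat.prime_three).mpr h3K
  have hσ3 : σ ^ 3 = 1 := pow_three_eq_one_of_finrank_eq_three hσ hFL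
  -- the generator `τ` of `Gal(L/K)` and `τστ = σ²`
  obtain ⟨τ, hτ⟩ := exists_algEquiv_ne_one_of_finrank_eq_two (K := K) (L := L) hKL
  have hττ : ∀ w : L, τ (τ w) = w := fun w => by
    rw [← AlgEquiv.mul_apply, mul_self_eq_one_of_finrank_eq_two hKL hτ, AlgEquiv.one_apply]
  have hτσ : ∀ z : L, τ (σ z) = σ (σ (τ z)) :=
    apply_apply_eq_of_generators hK hKL hτ F hF2 hζeq hσ hFL hm hθ3 hθσ
  have hτσσ : ∀ z : L, τ (σ (σ z)) = σ (τ z) := apply_apply_apply_eq F hσ hFL hτσ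
  -- on `𝓞 L`
  have hτσO : ∀ z : 𝓞 L, τ • σ • z = σ • σ • τ • z := fun z => RingOfIntegers.ext (hτσ z)
  have hτσσO : ∀ z : 𝓞 L, τ • σ • σ • z = σ • τ • z := fun z => RingOfIntegers.ext (hτσσ z)
  have hττO : ∀ z : 𝓞 L, τ • τ • z = z := fun z => RingOfIntegers.ext (hττ z)
  have hσσσO : ∀ z : 𝓞 L, σ • σ • σ • z = z := fun z => by
    rw [smul_smul, smul_smul, ← pow_three', hσ3, one_smul]
  -- on ideals
  have hτσI : ∀ J : Ideal (𝓞 L), τ • σ • J = σ • σ • τ • J := by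
    intro J
    simp only [Ideal.pointwise_smul_def, Ideal.map_map]
    congr 1
    ext z
    simp only [RingHom.coe_comp, Function.comp_apply, MulSemiringAction.toRingHom_apply, hτσO]
  have hσσσI : ∀ J : Ideal (𝓞 L), σ • σ • σ • J = J := fun J => by
    rw [smul_smul, smul_smul, ← pow_three', hσ3, one_smul]
  -- the norm form `Nσ z = z · σz · σ²z`
  set Nσ : 𝓞 L → 𝓞 L := fun z => z * σ • z * σ • σ • z with hNσ
  have hNσmul : ∀ a b, Nσ (a * b) = Nσ a * Nσ b := by
    intro a b
    simp only [hNσ, smul_mul']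
    ring
  have hNσσ : ∀ z, Nσ (σ • z) = Nσ z := by
    intro z
    simp only [hNσ, hσσσO]
    ring
  have hNστ : ∀ z, Nσ (τ • z) = τ • Nσ z := by
    intro z
    simp only [hNσ, smul_mul', hτσO, hσσσO]
    ring
  have hNσ0 : ∀ z, z ≠ 0 → Nσ z ≠ 0 := fun z hz =>
    mul_ne_zero (mul_ne_zero hz ((smul_ne_zero_iff_ne σ).mpr hz))
      ((smul_ne_zero_iff_ne σ).mpr ((smul_ne_zero_iff_ne σ).mpr hz))
  have hNσL : ∀ z : 𝓞 L, algebraMap F L (Algebra.norm F (z : L)) = (Nσ z : L) := by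
    intro z
    rw [algebraMap_norm_eq_of_finrank_eq_three hσ hFL]
    rfl
  -- (1) every `σ`-invariant ideal is principal
  have hprincK : ∀ {𝔭 : Ideal (𝓞 K)} {P : Ideal (𝓞 L)}, P.IsMaximal →
      𝔭.map (algebraMap (𝓞 K) (𝓞 L)) = P → (𝔭 ^ 3).IsPrincipal → P.IsPrincipal := by
    intro 𝔭 P hP h𝔭 h𝔭3
    haveI := hP
    have h𝔭0 : 𝔭 ≠ ⊥ := by
      intro h
      rw [h, Ideal.map_bot] at h𝔭
      exact (Ideal.IsMaximal.ne_bot_of_isIntegral_int P) h𝔭.symm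
    have hmem : 𝔭 ∈ (Ideal (𝓞 K))⁰ := mem_nonZeroDivisors_of_ne_zero h𝔭0
    have hmem3 : 𝔭 ^ 3 ∈ (Ideal (𝓞 K))⁰ := pow_mem hmem 3
    have h3 : ClassGroup.mk0 ⟨𝔭, hmem⟩ ^ 3 = 1 := by
      have : (⟨𝔭, hmem⟩ : (Ideal (𝓞 K))⁰) ^ 3 = ⟨𝔭 ^ 3, hmem3⟩ :=
        Subtype.ext (by rw [SubmonoidClass.coe_pow])
      rw [← map_pow, this]
      exact (ClassGroup.mk0_eq_one_iff hmem3).mpr h𝔭3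
    have hh : ClassGroup.mk0 ⟨𝔭, hmem⟩ ^ classNumber K = 1 := by
      rw [classNumber]
      exact pow_card_eq_one
    have h1 : ClassGroup.mk0 ⟨𝔭, hmem⟩ = 1 := by
      have : ClassGroup.mk0 ⟨𝔭, hmem⟩ ^ Nat.gcd 3 (classNumber K) = 1 :=
        pow_gcd_eq_one.mpr ⟨h3, hh⟩
      rwa [Nat.Coprime.gcd_eq_one hcop, pow_one] at this
    obtain ⟨g, hg⟩ := ((ClassGroup.mk0_eq_one_iff hmem).mp h1).principal
    refine ⟨⟨algebraMap (𝓞 K) (𝓞 L) g, ?_⟩⟩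
    rw [← h𝔭, hg, Ideal.submodule_span_eq, Ideal.map_span, Set.image_singleton,
      Ideal.submodule_span_eq]
  obtain ⟨g₁, hg₁⟩ := (hprincK hP₁ h𝔭₁ h𝔭₁3).principal
  obtain ⟨g₂, hg₂⟩ := (hprincK hP₂ h𝔭₂ h𝔭₂3).principal
  rw [Ideal.submodule_span_eq] at hg₁ hg₂
  have hprinc : ∀ J : Ideal (𝓞 L), J ≠ ⊥ → σ • J = J → Submodule.IsPrincipal J := by
    intro J hJ0 hJinv
    obtain ⟨c, a, b, -, -, hJ⟩ :=
      exists_eq_span_mul_pow σ hσ hPID hP₁ hP₂ ht₁ ht₂ hram J hJ0 hJinv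
    refine ⟨⟨algebraMap (𝓞 F) (𝓞 L) c * g₁ ^ a * g₂ ^ b, ?_⟩⟩
    rw [hJ, hg₁, hg₂, Ideal.span_singleton_pow, Ideal.span_singleton_pow,
      Ideal.span_singleton_mul_span_singleton, Ideal.span_singleton_mul_span_singleton,
      Ideal.submodule_span_eq]
  -- (2) a `σ`-fixed class of order `3` and its relation
  have h3card : 3 ∣ Fintype.card (ClassGroup (𝓞 L)) := h3L
  obtain ⟨I, hI1, hI3, hIfix⟩ := exists_fixed_class_of_three_dvd_card σ hσ3 h3card
  obtain ⟨x, y, hx, hy, hxy, u, hu⟩ := exists_rel_of_mk0_smul_eq σ hσ3 I hIfix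
  have hI0 : (I : Ideal (𝓞 L)) ≠ ⊥ := nonZeroDivisors.ne_zero I.2
  -- `u` is `σ`-fixed, hence in `F`, hence `±ζ^i`: `u · τu = 1`, `u⁶ = 1`
  change Nσ x * (u : 𝓞 L) = Nσ y at hu
  have hNσinv : ∀ z, σ • Nσ z = Nσ z := by
    intro z
    simp only [hNσ, smul_mul', hσσσO]
    ring
  have huσ : σ • ((u : 𝓞 L)) = u := by
    have h := congrArg (σ • ·) hu
    simp only [smul_mul', hNσinv] at h
    rw [← hu] at h
    exact mul_left_cancel₀ (hNσ0 x hx) h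
  have huσL : σ ((u : 𝓞 L) : L) = ((u : 𝓞 L) : L) := congrArg (fun w : 𝓞 L => (w : L)) huσ
  obtain ⟨f, hf⟩ : ∃ f : F, algebraMap F L f = ((u : 𝓞 L) : L) := by
    refine (IsGalois.mem_range_algebraMap_iff_fixed (F := F) ((u : 𝓞 L) : L)).mpr fun g => ?_
    rcases algEquiv_eq_of_forall_mem_zpowers F hσ hFL g with rfl | rfl | rfl
    · rfl
    · exact huσL
    · rw [AlgEquiv.mul_apply, huσL, huσL]
  obtain ⟨v, hv⟩ := exists_units_coe_eq_of_algebraMap_eq u hf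
  have hvL : ((u : 𝓞 L) : L) = algebraMap F L ((v : 𝓞 F) : F) := by rw [hv, hf]
  obtain ⟨ζL, hζLdef⟩ : ∃ ζL : L, ζL = algebraMap F L ((ζ : 𝓞 F) : F) := ⟨_, rfl⟩
  have hζL : ζL ^ 2 + ζL + 1 = 0 := by
    have h := congrArg (fun w : 𝓞 F => algebraMap F L (w : F)) hζeq
    rw [hζLdef]
    simpa using h
  have hζL3 : ζL ^ 3 = 1 := by linear_combination (ζL - 1) * hζL
  have hτζ : τ ζL = ζL ^ 2 := by
    have hroot : (τ ζL) ^ 2 + τ ζL + 1 = 0 := by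
      have h := congrArg τ hζL
      simpa using h
    rcases Honda1971.eq_or_eq_of_sq_add_self_add_one hζL hroot with h | h
    · exfalso
      obtain ⟨k, hk⟩ := exists_algebraMap_eq_of_fixed hKL hτ h
      apply sq_add_self_add_one_ne_zero hK k
      apply (algebraMap K L).injective
      rw [map_add, map_add, map_pow, map_one, map_zero, hk, hζL]
    · exact h
  obtain ⟨i, hi⟩ := hunits v
  have huL : ((u : 𝓞 L) : L) = ζL ^ i ∨ ((u : 𝓞 L) : L) = -ζL ^ i := by
    rcases hi with h | h
    · left
      rw [hvL, h, hζLdef]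
      simp
    · right
      rw [hvL, h, hζLdef]
      simp
  have huτL : ((u : 𝓞 L) : L) * τ ((u : 𝓞 L) : L) = 1 := by
    rcases huL with h | h
    · rw [h, map_pow, hτζ, ← pow_mul, ← pow_add, show i + 2 * i = 3 * i by ring, pow_mul,
        hζL3, one_pow]
    · rw [h, map_neg, map_pow, hτζ, neg_mul_neg, ← pow_mul, ← pow_add,
        show i + 2 * i = 3 * i by ring, pow_mul, hζL3, one_pow]
  have hu6L : ((u : 𝓞 L) : L) ^ 6 = 1 := by
    rcases huL with h | h
    · rw [h, ← pow_mul, show i * 6 = 3 * (2 * i) by ring, pow_mul, hζL3, one_pow]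
    · rw [h, neg_pow, ← pow_mul, show i * 6 = 3 * (2 * i) by ring, pow_mul, hζL3, one_pow]
      norm_num
  have huτ : (u : 𝓞 L) * τ • (u : 𝓞 L) = 1 := by
    refine RingOfIntegers.ext ?_
    push_cast
    exact huτL
  have hu6 : (u : 𝓞 L) ^ 6 = 1 := by
    refine RingOfIntegers.ext ?_
    push_cast
    exact hu6L
  have hNσu : Nσ u = (u : 𝓞 L) ^ 3 := by
    simp only [hNσ, huσ]
    ring
  have hNσpow : ∀ (z : 𝓞 L) (n : ℕ), Nσ (z ^ n) = Nσ z ^ n := by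
    intro z n
    induction n with
    | zero => simp [hNσ]
    | succ n ih => rw [pow_succ, hNσmul, ih, pow_succ]
  -- (3) the class `τc = [τI]`: relation `(στy)·σ(τI) = (στx)·τI` with the same unit `u`
  have hI'mem : τ • (I : Ideal (𝓞 L)) ∈ (Ideal (𝓞 L))⁰ := smul_mem_nonZeroDivisors τ I
  have hxy' : Ideal.span {σ • τ • y} * σ • τ • (I : Ideal (𝓞 L)) =
      Ideal.span {σ • τ • x} * τ • (I : Ideal (𝓞 L)) := by
    have h := congrArg (τ • ·) hxy
    simp only [smul_mul', pointwise_smul_span_singleton, hτσI] at h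
    have h2 := congrArg (σ • ·) h
    simp only [smul_mul', pointwise_smul_span_singleton, hσσσI] at h2
    exact h2.symm
  have hu' : Nσ (σ • τ • y) * (u : 𝓞 L) = Nσ (σ • τ • x) := by
    rw [hNσσ, hNσσ, hNστ, hNστ, ← hu, smul_mul', mul_assoc, mul_comm (τ • (u : 𝓞 L)), huτ,
      mul_one]
  -- (4) the product class `[I · τI]` is trivial
  set X : 𝓞 L := x * σ • τ • y with hXdef
  set Y : 𝓞 L := y * σ • τ • x with hYdef
  have hX0 : X ≠ 0 :=
    mul_ne_zero hx ((smul_ne_zero_iff_ne σ).mpr ((smul_ne_zero_iff_ne τ).mpr hy))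
  have hĨmem : (I : Ideal (𝓞 L)) * τ • (I : Ideal (𝓞 L)) ∈ (Ideal (𝓞 L))⁰ := mul_mem I.2 hI'mem
  have hXY : Ideal.span {X} * σ • ((I : Ideal (𝓞 L)) * τ • (I : Ideal (𝓞 L))) =
      Ideal.span {Y} * ((I : Ideal (𝓞 L)) * τ • (I : Ideal (𝓞 L))) := by
    calc Ideal.span {X} * σ • ((I : Ideal (𝓞 L)) * τ • (I : Ideal (𝓞 L)))
        = (Ideal.span {x} * σ • (I : Ideal (𝓞 L))) *
            (Ideal.span {σ • τ • y} * σ • τ • (I : Ideal (𝓞 L))) := by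
          rw [hXdef, ← Ideal.span_singleton_mul_span_singleton, smul_mul']
          ring
      _ = (Ideal.span {y} * (I : Ideal (𝓞 L))) *
            (Ideal.span {σ • τ • x} * τ • (I : Ideal (𝓞 L))) := by rw [hxy, hxy']
      _ = Ideal.span {Y} * ((I : Ideal (𝓞 L)) * τ • (I : Ideal (𝓞 L))) := by
          rw [hYdef, ← Ideal.span_singleton_mul_span_singleton]
          ring
  have hNXY : Nσ X * ((u : 𝓞 L) * u) = Nσ Y := by
    calc Nσ X * ((u : 𝓞 L) * u) = (Nσ x * u) * (Nσ (σ • τ • y) * u) := by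
          rw [hXdef, hNσmul]
          ring
      _ = Nσ y * Nσ (σ • τ • x) := by rw [hu, hu']
      _ = Nσ Y := by rw [hYdef, hNσmul]
  -- `[I·τI]^{h_K} = 1` and `[I·τI]^3 = 1`
  have hh : ClassGroup.mk0 ⟨_, hĨmem⟩ ^ classNumber K = 1 :=
    mk0_mul_smul_pow_classNumber hKL hτ (I : Ideal (𝓞 L)) hĨmem
  have hI3' : ClassGroup.mk0 ⟨τ • (I : Ideal (𝓞 L)), hI'mem⟩ ^ 3 = 1 := by
    have hmem3 : (I : Ideal (𝓞 L)) ^ 3 ∈ (Ideal (𝓞 L))⁰ := pow_mem I.2 3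
    have h3 : ClassGroup.mk0 ⟨(I : Ideal (𝓞 L)) ^ 3, hmem3⟩ = 1 := by
      have : (⟨(I : Ideal (𝓞 L)) ^ 3, hmem3⟩ : (Ideal (𝓞 L))⁰) = I ^ 3 :=
        Subtype.ext (by rw [SubmonoidClass.coe_pow])
      rw [this, map_pow, hI3]
    obtain ⟨g₃, hg₃⟩ := ((ClassGroup.mk0_eq_one_iff hmem3).mp h3).principal
    rw [Ideal.submodule_span_eq] at hg₃
    have hmem3' : (τ • (I : Ideal (𝓞 L))) ^ 3 ∈ (Ideal (𝓞 L))⁰ := pow_mem hI'mem 3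
    have : (⟨τ • (I : Ideal (𝓞 L)), hI'mem⟩ : (Ideal (𝓞 L))⁰) ^ 3 = ⟨_, hmem3'⟩ :=
      Subtype.ext (by rw [SubmonoidClass.coe_pow])
    rw [← map_pow, this, ClassGroup.mk0_eq_one_iff hmem3']
    refine ⟨⟨τ • g₃, ?_⟩⟩
    rw [← smul_pow', hg₃, pointwise_smul_span_singleton, Ideal.submodule_span_eq]
  have hĨ3 : ClassGroup.mk0 ⟨_, hĨmem⟩ ^ 3 = 1 := by
    have : (⟨_, hĨmem⟩ : (Ideal (𝓞 L))⁰) = I * ⟨τ • (I : Ideal (𝓞 L)), hI'mem⟩ :=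
      Subtype.ext rfl
    rw [this, map_mul, mul_pow, hI3, hI3', one_mul]
  have hĨ1 : ClassGroup.mk0 ⟨_, hĨmem⟩ = 1 := by
    have : ClassGroup.mk0 ⟨_, hĨmem⟩ ^ Nat.gcd 3 (classNumber K) = 1 :=
      pow_gcd_eq_one.mpr ⟨hĨ3, hh⟩
    rwa [Nat.Coprime.gcd_eq_one hcop, pow_one] at this
  obtain ⟨g, hg⟩ := ((ClassGroup.mk0_eq_one_iff hĨmem).mp hĨ1).principal
  rw [Ideal.submodule_span_eq] at hg
  have hg0 : g ≠ 0 := by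
    intro h0
    rw [h0, Ideal.span_singleton_eq_bot.mpr rfl] at hg
    exact (nonZeroDivisors.ne_zero hĨmem) hg
  -- comparing generators: `X · σg · η = Y · g`
  rw [hg, pointwise_smul_span_singleton, Ideal.span_singleton_mul_span_singleton,
    Ideal.span_singleton_mul_span_singleton] at hXY
  obtain ⟨η, hη⟩ := Ideal.span_singleton_eq_span_singleton.mp hXY
  -- norms: `N(η) = u²`
  have hNη : Nσ (η : 𝓞 L) = (u : 𝓞 L) * u := by
    have h := congrArg Nσ hη
    simp only [hNσmul, hNσσ] at h
    rw [← hNXY] at h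
    have h' : Nσ X * Nσ g * Nσ (η : 𝓞 L) = Nσ X * Nσ g * ((u : 𝓞 L) * u) := by
      linear_combination h
    exact mul_left_cancel₀ (mul_ne_zero (hNσ0 X hX0) (hNσ0 g hg0)) h'
  -- the unit `ε = η² u³` has `N(ε) = u = N(y/x)`
  set ε : (𝓞 L)ˣ := η ^ 2 * u ^ 3 with hεdef
  have hNε : Nσ (ε : 𝓞 L) = u := by
    have hεval : ((ε : (𝓞 L)ˣ) : 𝓞 L) = (η : 𝓞 L) ^ 2 * (u : 𝓞 L) ^ 3 := by
      rw [hεdef, Units.val_mul, Units.val_pow_eq_pow_val, Units.val_pow_eq_pow_val]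
    rw [hεval, hNσmul, hNσpow, hNσpow, hNη, hNσu]
    linear_combination ((u : 𝓞 L) ^ 7 + u) * hu6
  have hε : Algebra.norm F (((ε : 𝓞 L) : L)) = Algebra.norm F ((y : L) / x) := by
    apply (algebraMap F L).injective
    have hdiv : Algebra.norm F ((y : L) / x) = Algebra.norm F (y : L) / Algebra.norm F (x : L) := by
      rw [div_eq_mul_inv, map_mul, Algebra.norm_inv, div_eq_mul_inv]
    have hNx0L : ((Nσ x : 𝓞 L) : L) ≠ 0 := RingOfIntegers.coe_ne_zero_iff.mpr (hNσ0 x hx)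
    rw [hNσL, hNε, hdiv, map_div₀, hNσL, hNσL, eq_div_iff hNx0L, ← hu]
    push_cast
    ring
  exact hI1 (mk0_eq_one_of_rel hσ hFL hprinc I hx hy hxy ε hε)

end Summit.QuantumAdvantage.QuantumAdvantage.Theorems.LinnikCubicClassGroups
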